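import Summits.CriticalPhenomena.PercolationContinuityZ3.Theses.PercExchangeRateTransport
import Summits.CriticalPhenomena.PercolationContinuityZ3.Theorems.SubcritExchangeUniformity.Negative.VerticalRusso
import Summits.CriticalPhenomena.PercolationContinuityZ3.Theorems.PercExchangeRateTransportSubcritExchangeUniformityRussoPos
import Literature.Probability.LatticeModels.ProdBernoulliIndependence

/-!
# `SupercritExchangeUniformity` (K⁺, crux stmt-CriticalPhenomena-16061, route `PercExchangeRateTransport`),
# negative lane, part 3: the outer edges `{t ≥ 1}` and `{p ≥ 1}` are INERT — K⁺ has no typed guard on `ρ` or `hi`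

Load-bearing analysis from the crux disprover of K⁺ (cdisprove, cycle 1); nothing here asserts a Theses
decl; no definitions (objects of `…Theorems.SubcritExchangeUniformity.Negative.Objects`).

Contrast. In the K⁻ lane the corner `{p ≤ 0}` (where `∂_pΘ_n = 0 < ∂_tΘ_n`) makes the exchange-rate
inequality FAIL outright, which is the typed guard `δ(η) < p_c(t)` (`CutoffGuard`); in part 1 of this
lane (`PlanarEnd`) the edge `{t ≤ 0}` (where `∂_tΘ_n = 0 < ∂_pΘ_n`) forces a K⁺ field to VANISH. The two
remaining edges of the parameter square are different: there BOTH partial derivatives vanish, because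
the one-arm event `{0 ↔ ∂Λ_n}` becomes almost sure —

* `{t ≥ 1}` (§1): every vertical bond is open (`projIcc t = 1`), the column `0, e₃, …, n e₃ ∈ ∂Λ_n` is
  open a.s., `Θ_n(p,t) = 1` for every real `p` (`ThetaBox_eq_one_of_one_le_t`), hence
  `∂_pΘ_n(p,t) = 0` (constant slice) and `∂_tΘ_n(p,t) = 0` (slice constant on `[1,∞)`, uniqueness
  of derivatives within `Ici 1` or junk `0`);
* `{p ≥ 1}` (§2): every horizontal bond is open, the row `0, e₁, …, n e₁ ∈ ∂Λ_n` is open a.s.,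
  `Θ_n(p,t) = 1` for every real `t` (`ThetaBox_eq_one_of_one_le_p`), hence both partials vanish;

so at such points the K⁺ inequality `|∂_tΘ_n − a ∂_pΘ_n| ≤ η ∂_pΘ_n` reads `0 ≤ 0` and holds for EVERY
field `a` and every `η` (`clause_trivial_of_one_le_t`, `clause_trivial_of_one_le_p`). Consequences for
provers/planners: (i) unlike K⁻, K⁺ carries NO hidden constraint on the collar width — a collar
`[p_c(t), p_c(t) + ρ]` poking out of the square at `p ≥ 1` costs nothing in the `η`-clause (the
continuity and Lipschitz clauses there are at the prover's disposal); (ii) the hypothesis `hi < 1`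
guards only ASYMPTOTIC content (uniformity of the rate as `t ↑ 1`, where physically
`a(p_c(t),t) = −p_c′(t)` blows up like `C/(1−t)` and no continuous field on a collar reaching
`t = 1` could match it) — the level `t = 1` itself imposes nothing, so the `hi`-free variant of K⁺
is false (if at all) for an analytic reason that is not certifiable with the tree's present
uniform-in-`n` technology (Aizenman–Grimmett comparability holds on compacts of the open square only).

Tree lemmas used: `Objects`/`VerticalRusso` (`param_of_mem`, `τPT_of_vert`, `ThetaBox_eq`,
`Column.single_mem_box`, `Column.single_mem_innerBoundary`, `Column.single_adj_single_succ`,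
`Column.bond_mem_edgeSet`, `Column.isVert_bond`), `RussoPos` (`single_mem_box`,
`single_nat_mem_innerBoundary`, `zdGraph_adj_single_succ`), `prodBernoulli_real_subset`,
`DCT16.mem_siteToBoundary_iff`, Mathlib `uniqueDiffOn_Ici`.
-/

noncomputable section

namespace Summit.CriticalPhenomena.PercolationContinuityZ3.Theorems.SupercritExchangeUniformity.Negative

open MeasureTheory Filter Topology
open Literature.Probability.Percolation Literature.Probability.LatticeModels
open Literature.Probability.Percolation.DCT16
open Summit.CriticalPhenomena.PercolationContinuityZ3.Theorems.SubcritExchangeUniformity.Negative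
open Summit.CriticalPhenomena.PercolationContinuityZ3.Theorems.SubcritExchangeUniformity
  (single_mem_box single_nat_mem_innerBoundary zdGraph_adj_single_succ)

/-! ## §1 The edge `{t ≥ 1}`: `Θ_n ≡ 1`, both partials vanish, the K⁺ inequality is `0 ≤ 0` -/

/-- On `{t ≥ 1}` the parameter field is that of `t = 1` (the clamp `projIcc 0 1 t = 1`). [folklore] -/
theorem param_of_one_le_t (p : ℝ) {t : ℝ} (ht : 1 ≤ t) : param p t = param p 1 := by
  funext e
  by_cases he : e ∈ (zdGraph 3).edgeSet
  · rw [param_of_mem he, param_of_mem he]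
    by_cases hv : e ∈ vertBonds
    · rw [τPT_of_vert hv, τPT_of_vert hv, Set.projIcc_of_right_le _ ht, Set.projIcc_right]
    · rw [τPT_of_not_vert hv, τPT_of_not_vert hv]
  · rw [param_of_not_mem he, param_of_not_mem he]

/-- `Θ_n(p,t) = Θ_n(p,1)` for `t ≥ 1`. [folklore] -/
theorem ThetaBox_of_one_le_t (n : ℕ) (p : ℝ) {t : ℝ} (ht : 1 ≤ t) :
    ThetaBox n p t = ThetaBox n p 1 := by
  rw [ThetaBox_eq, ThetaBox_eq, param_of_one_le_t p ht]

/-- **If the whole column `s(k e₃, (k+1) e₃)`, `0 ≤ k < n`, is open then `0 ↔ ∂Λ_n in Λ_n`.**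
[folklore] -/
theorem mem_siteToBoundary_of_column_subset (n : ℕ) {ω : Set (Sym2 (Site 3))}
    (hω : (↑((Finset.range n).image fun k : ℕ =>
        s((Pi.single (2 : Fin 3) (k : ℤ) : Site 3), Pi.single (2 : Fin 3) ((k + 1 : ℕ) : ℤ))) :
          Set (Sym2 (Site 3))) ⊆ ω) :
    ω ∈ siteToBoundary 3 n := by
  rw [mem_siteToBoundary_iff]
  refine ⟨Pi.single 2 (n : ℤ), Column.single_mem_innerBoundary n, ?_⟩
  suffices h : ∀ k, k ≤ n → PathIn (openGraph ω) ↑(box 3 n) 0 (Pi.single (2 : Fin 3) (k : ℤ)) from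
    h n le_rfl
  intro k
  induction k with
  | zero =>
    intro _
    simp only [Nat.cast_zero, Pi.single_zero]
    exact PathIn.refl (zero_mem_box 3 n)
  | succ k ih =>
    intro hk
    refine (ih (Nat.le_of_succ_le hk)).tail ?_ (Column.single_mem_box hk)
    rw [openGraph_adj]
    refine ⟨hω ?_, (Column.single_adj_single_succ k).ne⟩
    exact Finset.mem_coe.2
      (Finset.mem_image.2 ⟨k, Finset.mem_range.2 (Nat.lt_of_succ_le hk), rfl⟩)

/-- For `t ≥ 1` the column is open almost surely: its bonds are vertical lattice edges of
parameter `projIcc t = 1`. [folklore] -/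
theorem real_column_subset_eq_one (n : ℕ) (p : ℝ) {t : ℝ} (ht : 1 ≤ t) :
    (prodBernoulli (param p t)).real {ω | (↑((Finset.range n).image fun k : ℕ =>
        s((Pi.single (2 : Fin 3) (k : ℤ) : Site 3), Pi.single (2 : Fin 3) ((k + 1 : ℕ) : ℤ))) :
          Set (Sym2 (Site 3))) ⊆ ω} = 1 := by
  rw [prodBernoulli_real_subset]
  refine Finset.prod_eq_one fun e he => ?_
  obtain ⟨k, -, rfl⟩ := Finset.mem_image.1 he
  rw [param_of_mem (Column.bond_mem_edgeSet k), τPT_of_vert (Column.isVert_bond k),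
    Set.projIcc_of_right_le _ ht]

/-- **`Θ_n(p,t) = 1` for every `t ≥ 1`, every real `p` and every `n`.** [folklore] -/
theorem ThetaBox_eq_one_of_one_le_t (n : ℕ) (p : ℝ) {t : ℝ} (ht : 1 ≤ t) : ThetaBox n p t = 1 := by
  rw [ThetaBox_eq]
  refine le_antisymm measureReal_le_one ?_
  calc (1 : ℝ) = (prodBernoulli (param p t)).real {ω | (↑((Finset.range n).image fun k : ℕ =>
        s((Pi.single (2 : Fin 3) (k : ℤ) : Site 3), Pi.single (2 : Fin 3) ((k + 1 : ℕ) : ℤ))) :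
          Set (Sym2 (Site 3))) ⊆ ω} := (real_column_subset_eq_one n p ht).symm
    _ ≤ _ := measureReal_mono fun ω hω => mem_siteToBoundary_of_column_subset n hω

/-- **`∂_pΘ_n(p,t) = 0` for `t ≥ 1`** (the `p`-slice is the constant `1`). [folklore] -/
theorem deriv_p_eq_zero_of_one_le_t (n : ℕ) (p : ℝ) {t : ℝ} (ht : 1 ≤ t) :
    deriv (fun q => ThetaBox n q t) p = 0 := by
  have h : (fun q => ThetaBox n q t) = fun _ => (1 : ℝ) :=
    funext fun q => ThetaBox_eq_one_of_one_le_t n q ht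
  rw [h, deriv_const]

/-- **`∂_tΘ_n(p,t) = 0` for `t ≥ 1`** (Mathlib's `deriv`): the `t`-slice is constant on `[1, ∞)`;
at `t = 1` by uniqueness of derivatives within `Ici 1`, or junk `0`. [folklore] -/
theorem deriv_t_eq_zero_of_one_le (n : ℕ) (p : ℝ) {t : ℝ} (ht : 1 ≤ t) :
    deriv (fun s => ThetaBox n p s) t = 0 := by
  by_cases hd : DifferentiableAt ℝ (fun s => ThetaBox n p s) t
  · have h1 : HasDerivWithinAt (fun s => ThetaBox n p s) (deriv (fun s => ThetaBox n p s) t)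
        (Set.Ici 1) t :=
      hd.hasDerivAt.hasDerivWithinAt
    have h2 : HasDerivWithinAt (fun s => ThetaBox n p s) 0 (Set.Ici 1) t :=
      (hasDerivWithinAt_const (x := t) (s := Set.Ici 1) (c := ThetaBox n p 1)).congr_of_mem
        (fun s hs => ThetaBox_of_one_le_t n p hs) ht
    exact (uniqueDiffOn_Ici 1 t ht).eq_deriv _ h1 h2
  · exact deriv_zero_of_not_differentiableAt hd

/-- **At a level `t ≥ 1` the K⁺ inequality is `0 ≤ 0`** — it holds for every field value `a`,
every `η`, every `n` and every real `p`: the hypothesis `hi < 1` excludes no typed junk, it guards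
asymptotic content only. [folklore] -/
theorem clause_trivial_of_one_le_t (n : ℕ) (p a η : ℝ) {t : ℝ} (ht : 1 ≤ t) :
    |deriv (fun s => ThetaBox n p s) t - a * deriv (fun q => ThetaBox n q t) p| ≤
      η * deriv (fun q => ThetaBox n q t) p := by
  rw [deriv_t_eq_zero_of_one_le n p ht, deriv_p_eq_zero_of_one_le_t n p ht]
  simp

/-! ## §2 The edge `{p ≥ 1}`: `Θ_n ≡ 1`, both partials vanish, the K⁺ inequality is `0 ≤ 0` -/

/-- On `{p ≥ 1}` the parameter field is that of `p = 1`. [folklore] -/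
theorem param_of_one_le_p {p : ℝ} (hp : 1 ≤ p) (t : ℝ) : param p t = param 1 t := by
  funext e
  by_cases he : e ∈ (zdGraph 3).edgeSet
  · rw [param_of_mem he, param_of_mem he]
    by_cases hv : e ∈ vertBonds
    · rw [τPT_of_vert hv, τPT_of_vert hv]
    · rw [τPT_of_not_vert hv, τPT_of_not_vert hv, Set.projIcc_of_right_le _ hp, Set.projIcc_right]
  · rw [param_of_not_mem he, param_of_not_mem he]

/-- `Θ_n(p,t) = Θ_n(1,t)` for `p ≥ 1`. [folklore] -/
theorem ThetaBox_of_one_le_p (n : ℕ) {p : ℝ} (hp : 1 ≤ p) (t : ℝ) :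
    ThetaBox n p t = ThetaBox n 1 t := by
  rw [ThetaBox_eq, ThetaBox_eq, param_of_one_le_p hp t]

/-- The row bonds `s(k e₁, (k+1) e₁)` are `x`-bonds, hence not vertical. [folklore] -/
theorem rowBond_not_vert (k : ℕ) :
    s((Pi.single (0 : Fin 3) (k : ℤ) : Site 3), Pi.single (0 : Fin 3) ((k : ℤ) + 1)) ∉ vertBonds := by
  rintro ⟨x, hx⟩
  rw [Sym2.eq_iff] at hx
  rcases hx with ⟨h0, h1⟩ | ⟨h0, h1⟩
  · have h := congr_fun h1 2
    rw [← h0] at h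
    simp at h
  · have h := congr_fun h0 2
    rw [← h1] at h
    simp at h

/-- **If the whole row `s(k e₁, (k+1) e₁)`, `0 ≤ k < n`, is open then `0 ↔ ∂Λ_n in Λ_n`.** [folklore] -/
theorem mem_siteToBoundary_of_row_subset (n : ℕ) {ω : Set (Sym2 (Site 3))}
    (hω : (↑((Finset.range n).image fun k : ℕ =>
        s((Pi.single (0 : Fin 3) (k : ℤ) : Site 3), Pi.single (0 : Fin 3) ((k : ℤ) + 1))) :
          Set (Sym2 (Site 3))) ⊆ ω) :
    ω ∈ siteToBoundary 3 n := by
  rw [mem_siteToBoundary_iff]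
  refine ⟨Pi.single 0 (n : ℤ), single_nat_mem_innerBoundary 0 n, ?_⟩
  suffices h : ∀ k, k ≤ n → PathIn (openGraph ω) ↑(box 3 n) 0 (Pi.single (0 : Fin 3) (k : ℤ)) from
    h n le_rfl
  intro k
  induction k with
  | zero =>
    intro _
    simp only [Nat.cast_zero, Pi.single_zero]
    exact PathIn.refl (zero_mem_box 3 n)
  | succ k ih =>
    intro hk
    have hmem : (Pi.single (0 : Fin 3) ((k + 1 : ℕ) : ℤ) : Site 3) ∈ box 3 n :=
      single_mem_box 0 (by omega) (by exact_mod_cast hk)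
    refine (ih (Nat.le_of_succ_le hk)).tail ?_ hmem
    rw [openGraph_adj]
    refine ⟨hω ?_, ?_⟩
    · refine Finset.mem_coe.2 (Finset.mem_image.2 ⟨k, Finset.mem_range.2 (Nat.lt_of_succ_le hk), ?_⟩)
      push_cast
      rfl
    · push_cast
      exact (zdGraph_adj_single_succ 0 (k : ℤ)).ne

/-- For `p ≥ 1` the row is open almost surely: its bonds are horizontal lattice edges of
parameter `projIcc p = 1`. [folklore] -/
theorem real_row_subset_eq_one (n : ℕ) {p : ℝ} (hp : 1 ≤ p) (t : ℝ) :
    (prodBernoulli (param p t)).real {ω | (↑((Finset.range n).image fun k : ℕ =>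
        s((Pi.single (0 : Fin 3) (k : ℤ) : Site 3), Pi.single (0 : Fin 3) ((k : ℤ) + 1))) :
          Set (Sym2 (Site 3))) ⊆ ω} = 1 := by
  rw [prodBernoulli_real_subset]
  refine Finset.prod_eq_one fun e he => ?_
  obtain ⟨k, -, rfl⟩ := Finset.mem_image.1 he
  rw [param_of_mem ((SimpleGraph.mem_edgeSet _).2 (zdGraph_adj_single_succ 0 (k : ℤ))),
    τPT_of_not_vert (rowBond_not_vert k), Set.projIcc_of_right_le _ hp]

/-- **`Θ_n(p,t) = 1` for every `p ≥ 1`, every real `t` and every `n`.** [folklore] -/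
theorem ThetaBox_eq_one_of_one_le_p (n : ℕ) {p : ℝ} (hp : 1 ≤ p) (t : ℝ) : ThetaBox n p t = 1 := by
  rw [ThetaBox_eq]
  refine le_antisymm measureReal_le_one ?_
  calc (1 : ℝ) = (prodBernoulli (param p t)).real {ω | (↑((Finset.range n).image fun k : ℕ =>
        s((Pi.single (0 : Fin 3) (k : ℤ) : Site 3), Pi.single (0 : Fin 3) ((k : ℤ) + 1))) :
          Set (Sym2 (Site 3))) ⊆ ω} := (real_row_subset_eq_one n hp t).symm
    _ ≤ _ := measureReal_mono fun ω hω => mem_siteToBoundary_of_row_subset n hω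

/-- **`∂_tΘ_n(p,t) = 0` for `p ≥ 1`** (the `t`-slice is the constant `1`). [folklore] -/
theorem deriv_t_eq_zero_of_one_le_p (n : ℕ) {p : ℝ} (hp : 1 ≤ p) (t : ℝ) :
    deriv (fun s => ThetaBox n p s) t = 0 := by
  have h : (fun s => ThetaBox n p s) = fun _ => (1 : ℝ) :=
    funext fun s => ThetaBox_eq_one_of_one_le_p n hp s
  rw [h, deriv_const]

/-- **`∂_pΘ_n(p,t) = 0` for `p ≥ 1`** (Mathlib's `deriv`): the `p`-slice is constant on `[1, ∞)`.
[folklore] -/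
theorem deriv_p_eq_zero_of_one_le_p (n : ℕ) {p : ℝ} (hp : 1 ≤ p) (t : ℝ) :
    deriv (fun q => ThetaBox n q t) p = 0 := by
  by_cases hd : DifferentiableAt ℝ (fun q => ThetaBox n q t) p
  · have h1 : HasDerivWithinAt (fun q => ThetaBox n q t) (deriv (fun q => ThetaBox n q t) p)
        (Set.Ici 1) p :=
      hd.hasDerivAt.hasDerivWithinAt
    have h2 : HasDerivWithinAt (fun q => ThetaBox n q t) 0 (Set.Ici 1) p :=
      (hasDerivWithinAt_const (x := p) (s := Set.Ici 1) (c := ThetaBox n 1 t)).congr_of_mem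
        (fun q hq => ThetaBox_of_one_le_p n hq t) hp
    exact (uniqueDiffOn_Ici 1 p hp).eq_deriv _ h1 h2
  · exact deriv_zero_of_not_differentiableAt hd

/-- **At a point `p ≥ 1` the K⁺ inequality is `0 ≤ 0`** — for every field value, every `η`, every
`n`, every real `t`: a K⁺ collar `[p_c(t), p_c(t) + ρ]` poking out of the square at `p ≥ 1` costs
nothing in the `η`-clause; K⁺ has no typed guard on `ρ` (contrast: K⁻'s `δ(η) < p_c(t)`,
`SubcritExchangeUniformity.Negative.delta_lt_pcurve`). [folklore] -/
theorem clause_trivial_of_one_le_p (n : ℕ) {p : ℝ} (hp : 1 ≤ p) (t a η : ℝ) :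
    |deriv (fun s => ThetaBox n p s) t - a * deriv (fun q => ThetaBox n q t) p| ≤
      η * deriv (fun q => ThetaBox n q t) p := by
  rw [deriv_t_eq_zero_of_one_le_p n hp t, deriv_p_eq_zero_of_one_le_p n hp t]
  simp

end Summit.CriticalPhenomena.PercolationContinuityZ3.Theorems.SupercritExchangeUniformity.Negative

end
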